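import Summits.Ventures.QEC.CircuitDistance.PortFibreLeaf
import HarnessLib

/-!
# P3-PORT addendum: EXTENDED GROUPS AND COMPLETIONS of a fibre leaf (venture QEC, experiment cell CDX, seat qec-cdx-type-2;
# the semantic half of the certificate-checked decider `PortFibreDecide`; generic — no circuit order, no code; nothing here
# asserts a value of `d_circ`)

A fibre leaf `L : Fibre.Leaf` (`PortFibreLeaf`) with budget `≤ 1` is REALISED iff one coordinate per group plus at most one null
coordinate cover every detector an even number of times. This file rephrases that as a COMPLETION problem over EXTENDED GROUPS:

* `Leaf.ecols L j` — for `j < k` the detector sets of the coordinates of group `j`; for `j ≥ k` the NULL group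
  `∅ :: (detector sets of the null coordinates)` (the empty choice and — only when `1 ≤ budget` — each null column); `Leaf.ecolsL` is
  the same as detector LISTS read by one `drop`/`take` per contiguous group (`Leaf.colsOf`, kernel-cheap), `Leaf.ecols_eq` the link.
* `Leaf.Completes L rem t` — one column per group of `rem` with symmetric difference `t`; `par Y s = |Y ∩ s| (mod 2)` and its
  additivity over symmetric differences (`par_symmDiff`, `par_xorOver`).
* **`Leaf.completes_of_realised`**: a realisation with budget `≤ 1` is a completion of the extended groups `0 … k` to parity `∅`.
-/

namespace Summit.Ventures.QEC.CircuitDistance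

namespace Fibre

/-! ## Extended groups and completions -/

/-- The detector set of coordinate `c`. -/
def Leaf.dset (L : Leaf) (c : ℕ) : Finset ℕ := (L.coordsOf c).toFinset

/-- KERNEL SIDE: the detector rows of a list of coordinates — by ONE `drop`/`take` when the coordinates form a contiguous range
inside the table (the common case; a lookup per coordinate costs the kernel ≈ 20 ms on an 800-row table), else by lookups. -/
def Leaf.colsOf (L : Leaf) (idx : List ℕ) : List (List ℕ) :=
  if idx = List.range' (idx.headD 0) idx.length ∧ idx.headD 0 + idx.length ≤ L.coords.length then
    (L.coords.drop (idx.headD 0)).take idx.length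
  else idx.map L.coordsOf

/-- `colsOf` is the list of lookups. -/
theorem Leaf.colsOf_eq (L : Leaf) (idx : List ℕ) : L.colsOf idx = idx.map L.coordsOf := by
  unfold Leaf.colsOf
  split_ifs with h
  · obtain ⟨hr, hlen⟩ := h
    conv_rhs => rw [hr]
    apply List.ext_getElem
    · simp only [List.length_take, List.length_drop, List.length_map, List.length_range']; omega
    · intro i h1 h2
      simp only [List.length_take, List.length_drop] at h1
      simp only [List.getElem_take, List.getElem_drop, List.getElem_map, List.getElem_range', Leaf.coordsOf, one_mul]
      rw [List.getD_eq_getElem _ _ (by omega)]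
  · rfl

/-- EXTENDED GROUP `j` as detector LISTS (kernel side): for `j < k` the detector rows of group `j`'s coordinates; for `j ≥ k` the
NULL group — the empty column, followed (only if the budget is positive) by the detector rows of the null coordinates. -/
def Leaf.ecolsL (L : Leaf) (j : ℕ) : List (List ℕ) :=
  if j < L.k then L.colsOf (L.group j) else [] :: (if 1 ≤ L.budget then L.colsOf L.nulls else [])

/-- EXTENDED GROUP `j` as detector SETS (semantic side). -/
def Leaf.ecols (L : Leaf) (j : ℕ) : List (Finset ℕ) :=
  if j < L.k then (L.group j).map L.dset else ∅ :: (if 1 ≤ L.budget then L.nulls.map L.dset else [])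

/-- The two presentations agree. -/
theorem Leaf.ecols_eq (L : Leaf) (j : ℕ) : L.ecols j = (L.ecolsL j).map List.toFinset := by
  unfold Leaf.ecols Leaf.ecolsL
  rw [L.colsOf_eq, L.colsOf_eq]
  by_cases hj : j < L.k
  · rw [if_pos hj, if_pos hj, List.map_map]; rfl
  · rw [if_neg hj, if_neg hj, List.map_cons, List.toFinset_nil]
    by_cases hb : 1 ≤ L.budget
    · rw [if_pos hb, if_pos hb, List.map_map]; rfl
    · rw [if_neg hb, if_neg hb, List.map_nil]

/-- Symmetric difference of the chosen columns over a list of groups. -/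
def xorOver (f : ℕ → Finset ℕ) : List ℕ → Finset ℕ
  | [] => ∅
  | g :: gs => symmDiff (f g) (xorOver f gs)

/-- A COMPLETION of the remaining groups `rem` to parity `t`: one column per remaining group with symmetric difference `t`. -/
def Leaf.Completes (L : Leaf) (rem : List ℕ) (t : Finset ℕ) : Prop :=
  ∃ f : ℕ → Finset ℕ, (∀ g ∈ rem, f g ∈ L.ecols g) ∧ xorOver f rem = t

/-! ## Parities in `ZMod 2` -/

/-- The PAIRING `⟨Y, s⟩ = |Y ∩ s| mod 2`. -/
def par (Y s : Finset ℕ) : ZMod 2 := ((Y ∩ s).card : ZMod 2)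

/-- The pairing as a sum of indicators. -/
theorem par_eq_sum (Y s : Finset ℕ) : par Y s = ∑ y ∈ Y, (if y ∈ s then (1 : ZMod 2) else 0) := by
  unfold par; rw [← Finset.filter_mem_eq_inter, Finset.natCast_card_filter]

/-- The pairing is additive under symmetric difference. -/
theorem par_symmDiff (Y a b : Finset ℕ) : par Y (symmDiff a b) = par Y a + par Y b := by
  rw [par_eq_sum, par_eq_sum, par_eq_sum, ← Finset.sum_add_distrib]
  refine Finset.sum_congr rfl fun y _ => ?_
  have h11 : (1 : ZMod 2) + 1 = 0 := by decide
  by_cases ha : y ∈ a <;> by_cases hb : y ∈ b <;> simp [Finset.mem_symmDiff, ha, hb, h11]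

/-- The pairing of an `xorOver` is the sum of the pairings. -/
theorem par_xorOver (Y : Finset ℕ) (f : ℕ → Finset ℕ) (rem : List ℕ) :
    par Y (xorOver f rem) = (rem.map fun g => par Y (f g)).sum := by
  induction rem with
  | nil => simp [xorOver, par]
  | cons g gs ih => rw [xorOver, par_symmDiff, ih, List.map_cons, List.sum_cons]

/-- `xorOver` does not depend on the order of the groups. -/
theorem xorOver_perm (f : ℕ → Finset ℕ) {l l' : List ℕ} (h : l.Perm l') : xorOver f l = xorOver f l' := by
  induction h with
  | nil => rfl
  | cons x _ ih => rw [xorOver, xorOver, ih]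
  | swap x y l => rw [xorOver, xorOver, xorOver, xorOver, symmDiff_left_comm]
  | trans _ _ ih₁ ih₂ => rw [ih₁, ih₂]

/-- Sum of indicators over a list = number of hits. -/
theorem sum_ite_mem_eq_length (rem G : List ℕ) :
    (rem.map fun g => if g ∈ G then (1 : ZMod 2) else 0).sum = ((rem.filter (· ∈ G)).length : ZMod 2) := by
  induction rem with
  | nil => simp
  | cons g gs ih =>
    rw [List.map_cons, List.sum_cons, ih, List.filter_cons]
    by_cases hg : g ∈ G
    · simp [hg, add_comm]
    · simp [hg]

/-- A list sum over `List.range` is a `Finset.range` sum. -/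
theorem sum_map_range (h : ℕ → ZMod 2) (n : ℕ) : ((List.range n).map h).sum = ∑ i ∈ Finset.range n, h i := by
  induction n with
  | zero => simp
  | succ n ih => rw [List.range_succ, List.map_append, List.sum_append, ih, Finset.sum_range_succ]; simp

/-! ## From a realisation to a completion -/

/-- `d ∈ s` iff the pairing with `{d}` is `1`. -/
theorem par_singleton_eq_one_iff (d : ℕ) (s : Finset ℕ) : par {d} s = 1 ↔ d ∈ s := by
  unfold par
  by_cases hd : d ∈ s
  · rw [Finset.singleton_inter_of_mem hd, Finset.card_singleton]; simp [hd]
  · rw [Finset.singleton_inter_of_notMem hd, Finset.card_empty]; simp [hd]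

/-- The pairing of a `dset` with `{d}` is the indicator of `d ∈ coordsOf`. -/
theorem par_singleton_dset (L : Leaf) (d c : ℕ) : par {d} (L.dset c) = if d ∈ L.coordsOf c then 1 else 0 := by
  by_cases h : d ∈ L.coordsOf c
  · rw [if_pos h]; exact (par_singleton_eq_one_iff d _).2 (by unfold Leaf.dset; rw [List.mem_toFinset]; exact h)
  · rw [if_neg h]
    have : ¬ (par {d} (L.dset c) = 1) := fun h1 => h ((List.mem_toFinset).1 ((par_singleton_eq_one_iff d _).1 h1))
    have key : ∀ x : ZMod 2, ¬ x = 1 → x = 0 := by decide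
    exact key _ this

/-- **A realisation (budget `≤ 1`) is a completion of all extended groups to parity `∅`.** -/
theorem Leaf.completes_of_realised (L : Leaf) (hb : L.budget ≤ 1) (h : L.Realised) :
    L.Completes (List.range (L.k + 1)) ∅ := by
  classical
  obtain ⟨pick, N, hpick, hN, hNcard, heven⟩ := h
  let f : ℕ → Finset ℕ := fun j => if hj : j < L.k then L.dset (pick ⟨j, hj⟩) else N.sup L.dset
  have hN1 : N.card ≤ 1 := hNcard.trans hb
  refine ⟨f, fun g hg => ?_, ?_⟩
  · rw [List.mem_range] at hg
    by_cases hgk : g < L.k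
    · simp only [f, dif_pos hgk, Leaf.ecols, if_pos hgk]
      exact List.mem_map.2 ⟨_, hpick ⟨g, hgk⟩, rfl⟩
    · simp only [f, dif_neg hgk, Leaf.ecols, if_neg hgk]
      rcases Nat.lt_or_ge N.card 1 with h0 | h1
      · have hNe : N = ∅ := Finset.card_eq_zero.1 (by omega)
        rw [hNe, Finset.sup_empty]; exact List.mem_cons_self
      · obtain ⟨c, hc⟩ := Finset.card_eq_one.1 (le_antisymm hN1 h1)
        have hcN : c ∈ N := by rw [hc]; exact Finset.mem_singleton_self _
        have hbud : 1 ≤ L.budget := le_trans (by rw [hc, Finset.card_singleton]) hNcard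
        rw [hc, Finset.sup_singleton, if_pos hbud]
        exact List.mem_cons_of_mem _ (List.mem_map.2 ⟨c, hN c hcN, rfl⟩)
  · -- every detector is covered an even number of times
    ext d
    simp only [Finset.notMem_empty, iff_false]
    intro hd
    have h1 : par {d} (xorOver f (List.range (L.k + 1))) = 1 := (par_singleton_eq_one_iff d _).2 hd
    rw [par_xorOver, List.range_succ, List.map_append, List.sum_append, List.map_singleton, List.sum_singleton] at h1
    -- the group part
    have hgroups : ((List.range L.k).map fun g => par {d} (f g)).sum =
        ((Finset.univ.filter fun j : Fin L.k => d ∈ L.coordsOf (pick j)).card : ZMod 2) := by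
      rw [Finset.natCast_card_filter, sum_map_range, ← Fin.sum_univ_eq_sum_range (fun g => par {d} (f g)) L.k]
      refine Finset.sum_congr rfl fun j _ => ?_
      simp only [f, dif_pos j.2, Fin.eta, par_singleton_dset]
    -- the null part
    have hnull : par {d} (f L.k) = ((N.filter fun c => d ∈ L.coordsOf c).card : ZMod 2) := by
      simp only [f, lt_irrefl, dif_neg, not_false_eq_true]
      rcases Nat.lt_or_ge N.card 1 with h0 | h1'
      · have hNe : N = ∅ := Finset.card_eq_zero.1 (by omega)
        rw [hNe, Finset.sup_empty, Finset.filter_empty, Finset.card_empty]; simp [par]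
      · obtain ⟨c, hc⟩ := Finset.card_eq_one.1 (le_antisymm hN1 h1')
        rw [hc, Finset.sup_singleton, par_singleton_dset, Finset.filter_singleton]
        by_cases hdc : d ∈ L.coordsOf c <;> simp [hdc]
    rw [hgroups, hnull, ← Nat.cast_add] at h1
    obtain ⟨r, hr⟩ := heven d
    rw [hr] at h1
    have : ((r + r : ℕ) : ZMod 2) = 0 := by
      rw [Nat.cast_add]; have key : ∀ x : ZMod 2, x + x = 0 := by decide
      exact key _
    rw [this] at h1
    exact zero_ne_one h1

end Fibre

end Summit.Ventures.QEC.CircuitDistance
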